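import Summits.QuantumFields.BalabanUV.T4Continuum.Support.B13StepOfRecordSecantStructuralOn
import Summits.QuantumFields.BalabanUV.T4Continuum.Support.B13StepEnvelopeEnd

/-!
# NE5 ∕ U3 — E8[rec] RE-POINTED OVER A MEASURABLE OPERATOR CARRIER (row owner's RULING R20 (i)), part 2 of 2: the STRUCTURAL SECANT END
# for BAŁABAN's SLOTS OF RECORD RESTRICTED TO A SUB-SLOT `M ≤ OpDatum E` containing both runs' operator data (of record: `M := measOp`) —
# SAME ROOT `NE5 (B13StepOfRecord.outA S₀ E₀ cB) (B13StepOfRecord.outB S₀ E₀ cB) W κ θ′ C₅`, SAME LETTERS, SAME `C₅` as p214566, the W2-op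
# binder `ActOpFibre` (∕ `ActOpIntegral` ∕ `ActOpLineAnalyticOn`) now quantifying over operator lines IN `↥M`: THE R20 CAVEAT ON E8[rec] LIFTED

Cell `pub-balaban`, unit `b2b-balaban-t4-ne5-formalise-leaf-01` (NE5 formalisation swarm, LEAF PROVER 01, gen 6; journal INTENT l.11223, API
note l.11379).  A FOLLOWER of this lineage's `B13StepOfRecordSecantStructural` p214566 ∕ `B13StepOfRecordSecantLine` p215054 consuming part 1
(`B13StepOfRecordSecantStructuralOn`), leaf-03-g6's `B13StepOfRecordSub` (`onSub`, `restrict`, `outA_restrict`∕`outB_restrict`, the `Iff.rfl`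
transfers, `operatorRate_onSub_of_weightedEntrywise`, `boxInClass`) and leaf-03's bridge `B13StepEnvelopeEnd.actOpFibre_of_actOpLineAnalyticOn`
BY NAME; nothing landed is edited.  Summits-side NEW WORK under the LEAN PLACEMENT RULE (cell bookkeeping; 0 `def`, 0 cite tag).
HONEST FRAMING: rung (B)+1 of the FINITE-VOLUME T⁴ continuum programme — NOT infinite volume, NOT a mass gap, NOT the Clay problem, and
**NOT A PROOF OF NE5, NOR OF W2-op, NOR OF W2-ins**: both walls stay RELOCATED TO STRUCTURE exactly as in p214566 and part 1 (locators there: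
[Balaban1988RG2Cluster] (2.15)–(2.17) pp. 15–16, Lemma 1 (1.34)∕(1.36) p. 9, Lemma 3 (2.38) p. 20; [Balaban1987RG1] (1.9)∕(1.18) pp. 261∕263 —
KIND only); every other analytic input is a DISPLAYED HYPOTHESIS.  WHAT R20 CHANGES: NOT an estimate — the CARRIER of the operator-line
binder: over `Op := OpDatum E = ℓ^∞(E)` with `x`-INDEXED species the binder `hfib` of p214566 quantifies over directions with non-measurable
`x`-sections and is unsatisfiable for cores integrating over `x` (G-ne5p2-5 class, R20); over `↥M`, `M := measOp`, it quantifies over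
directions IN the measurable slot only — satisfiable in principle.  HONEST DEPENDENCY (cell line, verbatim): continuum YM on T⁴ ⇐ BetaPertH
∧ nine spine estimates (0/9 proved); BetaPertH ⇐ (D1) ∧ (D4) ∧ CAP+tail; G-an2-4 gates asym, D1 and NE2/3/4.

WHAT THIS FILE DOES (every theorem concludes `T4OutputRate.NE5 …` BY NAME).
* §3 **`ne5_of_record_onSub_secant_structural`** — part 1 §2 for the slots of record ON A SUB-SLOT `M ∋` both runs' operator data of record
  with cores typed on `↥M` (leaf-03's `onSub S₀ M hMA hMB act`): W1 PRODUCED from row NE2's ENTRY currency OF RECORD along the isometric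
  inclusion (leaf-03's `operatorRate_onSub_of_weightedEntrywise`); reading ∕ slice budgets ∕ the insertion COMPOSITION shape, datum
  membership and insertion rate OF THE MODEL OF RECORD's insertion-operator species transferred DEFINITIONALLY (insertions and history margins
  are unchanged); and **`ne5_of_record_restrict_secant_structural`** — cores := `S₀.act` READ THROUGH THE INCLUSION (`restrict S₀ M hMA hMB`):
  EXACTLY p214566's displayed binder list except that `hfib`, `hexp`, `hN`, `habs` are stated over the sub-slot model ∕ ball class (operator
  lines `p.1 + ζ•u`, `u ∈ M`; the class = the preimage of `ballClass (selfCtr …) ROp RHist` in `↥M × Hist`, leaf-03's `mem_ballClass_onSub_iff`),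
  PLUS the one-run membership side conditions `hMA`∕`hMB` (for `M := measOp`: route P2's `assemble_mem_measOp`, leaf-03's `opA_mem_measOp` ∕
  `opB_mem_measOp`); conclusion LITERALLY `NE5 (B13StepOfRecord.outA S₀ E₀ cB) (B13StepOfRecord.outB S₀ E₀ cB) W κ θ′ C₅`, p214566's `C₅`
  VERBATIM (`outA_restrict`∕`outB_restrict`, `rfl`).
* §4 at the restricted slots, one level down ∕ across on the operator side: **`ne5_of_record_restrict_secant_integral`** (owner's
  `ActOpIntegral` over `↥M` via `actOpFibre_of_integral`; twin of p214566 §4) and **`ne5_of_record_restrict_secant_lineAnalytic`** (the Cauchy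
  route's factor datum `ActOpLineAnalyticOn` + norm majorant on the sub-slot class + ROOM, via leaf-03's bridge; twin of p215054 §1 — E8[rec]
  and leaf-03's E9[rec]-sub read ONE common operator binder over `↥M`).
* §5 **`exists_ne5_of_record_restrict_secant_structural`** — leaf L10's letters `k₀`, `B` eliminated (`reach_scale_exists`, `first_scales_const`, `E₁ := 1`).
CENSUS vs p214566 (decls, not adjectives): MINUS = ∅, PLUS = [hMA, hMB]; CHANGED CARRIER (not head) = [hfib ∕ hint ∕ hact+hAK, hexp, hN, habs]
(`OpDatum E ↦ ↥M`); constant IDENTICAL.  Nothing is asserted about [II]'s kernels ∕ potentials ∕ terms; nothing of print is discharged;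
the zero-package witness p214898 (`E := Unit`) is unaffected.  0 sorry; axioms ⊆ {propext, Classical.choice, Quot.sound}.
-/

noncomputable section

open Metric Set MeasureTheory

namespace Summit.QuantumFields.BalabanUV.T4Continuum.B13StepOfRecordSecantStructuralSub

open Literature.MathematicalPhysics.QuantumFieldTheory.Balaban1983to89
open Literature.MathematicalPhysics.QuantumFieldTheory.Balaban1983to89.T4OutputRate (DecayBound NE5)
open Literature.MathematicalPhysics.QuantumFieldTheory.Balaban1983to89.T4InputCauchyRateSpecies (ballClass)
open Summit.QuantumFields.BalabanUV.T4Continuum.B13Carriers (TwoRuns)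
open Summit.QuantumFields.BalabanUV.T4Continuum.B13OpDatum (OpDatum)
open Summit.QuantumFields.BalabanUV.T4Continuum.B13OpDatumJunctions (opOf RawBounded WeightedEntrywiseRate)
open Summit.QuantumFields.BalabanUV.T4Continuum.B13StepTermLabels (InnerLabel)
open Summit.QuantumFields.BalabanUV.T4Continuum.B13StepTermFamily (ActData ActExpLinearOn)
open Summit.QuantumFields.BalabanUV.T4Continuum.B13StepTermSocket (labelsIndexing touchInc)
open Summit.QuantumFields.BalabanUV.T4Continuum.B13InnerData (Bnd b13InnerData)
open Summit.QuantumFields.BalabanUV.T4Continuum.UrsellTermBudget (actSum)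
open Summit.QuantumFields.BalabanUV.T4Continuum.B13TermHistSecant (ActExpNormBound ActAbsBound)
open Summit.QuantumFields.BalabanUV.T4Continuum.B13DomainGeometryTR (domainGeometry)
open Summit.QuantumFields.BalabanUV.T4Continuum.B13Base (selfCtr)
open Summit.QuantumFields.BalabanUV.T4Continuum.B13StepOfRecord (Slots assembly step)
open Summit.QuantumFields.BalabanUV.T4Continuum.OutputRateActOpFibre (ActOpFibre ActOpIntegral actOpFibre_of_integral)
open Summit.QuantumFields.BalabanUV.T4Continuum.OutputRateInsertionStructural (InsOpComposition)
open Summit.QuantumFields.BalabanUV.T4Continuum.B13TermOpEnvelope (ActOpLineAnalyticOn)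
open Summit.QuantumFields.BalabanUV.T4Continuum.B13StepEnvelopeEnd (actOpFibre_of_actOpLineAnalyticOn)
open Summit.QuantumFields.BalabanUV.T4Continuum.B13StepOfRecordSub (assemblyOn stepOn onSub restrict)
open Summit.QuantumFields.BalabanUV.T4Continuum.B13StepOfRecordSecantStructuralOn (ne5_of_recordOn_secant_structural)

/-! ## §3 E8[rec] structural FOR THE SLOTS OF RECORD ON A SUB-SLOT `M` CONTAINING THE DATA OF RECORD (R20's re-point) -/

section OnSub

variable {𝔾 : Type} [GaugeGroup 𝔾] {R : TwoRuns 𝔾} {E IOp Hist Ω : Type*} [NormedAddCommGroup Hist] [NormedSpace ℂ Hist]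
  [CompleteSpace Hist] [NormedAddCommGroup IOp] [NormedSpace ℂ IOp] [MeasurableSpace Ω] (S₀ : Slots R E IOp Hist)
  (M : Submodule ℂ (OpDatum E)) (hMA : ∀ g V k, opOf S₀.F S₀.rawA g V k ∈ M) (hMB : ∀ g U k, opOf S₀.F S₀.rawB g U k ∈ M)
  (act : R.carriers.Dom → InnerLabel R.carriers.Dom (Bnd R) → M → Hist → ℂ) (E₀ cB : ℝ)

/-- [folklore] **E8[rec] STRUCTURAL FOR THE SLOTS OF RECORD ON THE SUB-SLOT `M`, CORES TYPED ON `↥M`** (`onSub S₀ M hMA hMB act`): reading,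
run-B slice budget OF THE ASSEMBLY OF RECORD, run-A slice budget and the insertion COMPOSITION shape ∕ datum membership ∕ insertion rate OF THE
MODEL OF RECORD (definitional transfers — insertions and history margins unchanged), quoted levels for the sub-slot model's outputs, W1 PRODUCED
from row NE2's ENTRY currency OF RECORD along `M.subtypeL` (leaf-03's `operatorRate_onSub_of_weightedEntrywise`), **`ActOpFibre` for `act` over
operator lines IN `M`**, the history side's per-activity data for `act` on the sub-slot ball class (leaf-03's `mem_ballClass_onSub_iff`), radii,
numerics ⟹ `NE5 (outA (onSub …) E₀ cB) (outB (onSub …) E₀ cB) W κ θ′ C₅`, p214566's `C₅` verbatim.  NOT a proof of NE5. -/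
theorem ne5_of_record_onSub_secant_structural {W : Set (ℕ → ℝ)} {ROp RHist : ℕ → ℝ}
    {N A A' Aop Aop' : ℕ → (ℕ → ℝ) → R.carriers.BgB → R.carriers.Dom → InnerLabel R.carriers.Dom (Bnd R) → ℝ}
    {Dt : ActData R.carriers.Dom (InnerLabel R.carriers.Dom (Bnd R)) M Hist Ω}
    {κ Nbar ε εop Rt EA₀ E₁ cA c₁ r₀ Gi δI ρ₁ θ θ' ρ₀ B : ℝ} {k₀ k₁ : ℕ} (rI : ℕ → ℝ) (hrI : ∀ k, 0 < rI k)
    {Cfg : ℕ → Type*} [∀ k, NormedAddCommGroup (Cfg k)] [∀ k, NormedSpace ℂ (Cfg k)] {cfg : ∀ k, IOp → Cfg k}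
    {Φ : ∀ k, (R.carriers.Dom → ℝ) → Cfg k → Hist} {𝒪 : ℕ → (ℕ → ℝ) → R.carriers.BgB → Set IOp}
    {Dc : ∀ k, (ℕ → ℝ) → R.carriers.BgB → Set (Cfg k)}
    (hT : (assembly S₀).TransportReads W)
    (hbB : (assembly S₀).SliceBudgetB W κ cB) (hbA : S₀.D.SliceBudget (step S₀ E₀ cB) W κ cA)
    (hdA : DecayBound (B13StepOfRecordSub.outA (onSub S₀ M hMA hMB act) E₀ cB) W EA₀ κ) (hdB : DecayBound (B13StepOfRecordSub.outB (onSub S₀ M hMA hMB act) E₀ cB) W E₀ κ)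
    (hRA : RawBounded S₀.F (assembly S₀).rawAt W) (hRB : RawBounded S₀.F S₀.rawB W)
    (hwer : WeightedEntrywiseRate S₀.F (assembly S₀).rawAt S₀.rawB W c₁ fun k => θ ^ k) (hfl : ∀ k, r₀ ≤ S₀.rOp k)
    (hcomp : InsOpComposition (S₀.D.toInsOpModel (step S₀ E₀ cB) rI hrI) W κ E₀ Gi cfg Φ 𝒪 Dc)
    (hIA : ∀ k, ∀ g ∈ W, ∀ (U : R.carriers.BgB), (S₀.D.toInsOpModel (step S₀ E₀ cB) rI hrI).opIA g U k ∈ 𝒪 k g U)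
    (hirate : (S₀.D.toInsOpModel (step S₀ E₀ cB) rI hrI).InsOpRate W δI θ) (hδI : 0 ≤ δI) (hGi : 0 ≤ Gi) (hρ₁ : ρ₁ < 1)
    (hreachI : δI * θ ^ k₁ ≤ ρ₁)
    (hfib : ActOpFibre (labelsIndexing (domainGeometry R) (b13InnerData R)) act (stepOn (onSub S₀ M hMA hMB act) E₀ cB) W Aop)
    (hAop0 : ∀ k g U Z ℓ, 0 ≤ Aop k g U Z ℓ) (hAop0' : ∀ k g U Z ℓ, 0 ≤ Aop' k g U Z ℓ)
    (hdecop : ∀ k g U Z ℓ, Aop k g U Z ℓ ≤ Aop' k g U Z ℓ * Real.exp (-(κ * (R.carriers.d Z + 5)))) (hεop : 0 ≤ εop)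
    (h238op : ∀ k, ∀ g ∈ W, ∀ (U : R.carriers.BgB), ∀ Z ∈ R.domAt k,
      actSum (b13InnerData R) (Aop' k g U) k Z ≤ εop * Real.exp (-(Rt * R.carriers.d Z)))
    (hΦopsmall : 36 * (εop * Real.exp 64 * B12TreeDecay.K₀ (4 * 2 ^ 4) (2 * 4)) < 1)
    (hexp : ActExpLinearOn (labelsIndexing (domainGeometry R) (b13InnerData R)) act Dt
      (ballClass (selfCtr (assemblyOn (onSub S₀ M hMA hMB act)).raw (assemblyOn (onSub S₀ M hMA hMB act)).histRef) ROp RHist) W)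
    (hN : ActExpNormBound (labelsIndexing (domainGeometry R) (b13InnerData R)) Dt
      (ballClass (selfCtr (assemblyOn (onSub S₀ M hMA hMB act)).raw (assemblyOn (onSub S₀ M hMA hMB act)).histRef) ROp RHist) W S₀.rHist N)
    (hN0 : ∀ k g U Z ℓ, 0 ≤ N k g U Z ℓ) (hNle : ∀ k g U Z ℓ, N k g U Z ℓ ≤ Nbar) (hNbar : 0 ≤ Nbar)
    (habs : ActAbsBound (labelsIndexing (domainGeometry R) (b13InnerData R)) Dt
      (ballClass (selfCtr (assemblyOn (onSub S₀ M hMA hMB act)).raw (assemblyOn (onSub S₀ M hMA hMB act)).histRef) ROp RHist) W A)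
    (hA0 : ∀ k g U Z ℓ, 0 ≤ A k g U Z ℓ) (hA0' : ∀ k g U Z ℓ, 0 ≤ A' k g U Z ℓ) (hκ : 0 ≤ κ)
    (hdec : ∀ k g U Z ℓ, A k g U Z ℓ ≤ A' k g U Z ℓ * Real.exp (-(κ * (R.carriers.d Z + 5))))
    (hε : 0 ≤ ε)
    (h238 : ∀ k, ∀ g ∈ W, ∀ (U : R.carriers.BgB), ∀ Z ∈ R.domAt k,
      actSum (b13InnerData R) (A' k g U) k Z ≤ ε * Real.exp (-(Rt * R.carriers.d Z)))
    (hRt : 64 * Real.log 162 + 64 ≤ Rt) (hΦsmall : 36 * (ε * Real.exp 64 * B12TreeDecay.K₀ (4 * 2 ^ 4) (2 * 4)) < 1)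
    (hOp : ∀ k, c₁ / r₀ * S₀.rOp k ≤ ROp k) (hHist : ∀ k, (assembly S₀).bHist E₀ cB k ≤ RHist k)
    (hHistA : ∀ k, (Gi * δI / (1 - ρ₁) + 2 * Gi / θ ^ k₁) * S₀.rHist k + EA₀ * (S₀.rHist k * (cA / (1 - S₀.D.ω))) ≤ RHist k)
    (hEA₀ : 0 ≤ EA₀) (hE₀ : 0 ≤ E₀) (hE₁ : 0 < E₁) (hcA : 0 ≤ cA) (hcB : 0 ≤ cB)
    (hc₁ : 0 ≤ c₁) (hr₀ : 0 < r₀) (hθ0 : 0 < θ) (hθθ' : θ ≤ θ') (hθ'1 : θ' ≤ 1) (hω : 0 < S₀.D.ω)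
    (hω1 : S₀.D.ω < 1) (hρ₀ : 0 ≤ ρ₀) (hρ₀1 : ρ₀ < 1) (hreach : c₁ / r₀ * θ ^ k₀ ≤ ρ₀) (hB : 0 ≤ B)
    (hfirst : ∀ k < k₀, EA₀ + E₀ ≤ B * θ ^ k)
    (hsmall : S₀.D.ω + 2 * (Nbar * ((ε * Real.exp 64 * B12TreeDecay.K₀ (4 * 2 ^ 4) (2 * 4)) /
          (1 - 36 * (ε * Real.exp 64 * B12TreeDecay.K₀ (4 * 2 ^ 4) (2 * 4))) ^ 2)) * cA < θ') :
    NE5 (B13StepOfRecordSub.outA (onSub S₀ M hMA hMB act) E₀ cB) (B13StepOfRecordSub.outB (onSub S₀ M hMA hMB act) E₀ cB) W κ θ'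
      (((1 / (1 - ρ₀) * ((εop * Real.exp 64 * B12TreeDecay.K₀ (4 * 2 ^ 4) (2 * 4)) /
          (1 - 36 * (εop * Real.exp 64 * B12TreeDecay.K₀ (4 * 2 ^ 4) (2 * 4))) ^ 2)) * (c₁ / r₀) + 2 * (Nbar * ((ε * Real.exp 64 * B12TreeDecay.K₀ (4 * 2 ^ 4) (2 * 4)) /
          (1 - 36 * (ε * Real.exp 64 * B12TreeDecay.K₀ (4 * 2 ^ 4) (2 * 4))) ^ 2)) *
          (Gi * δI / (1 - ρ₁) + 2 * Gi / θ ^ k₁) + B) * (θ' - S₀.D.ω) /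
        (θ' - (S₀.D.ω + 2 * (Nbar * ((ε * Real.exp 64 * B12TreeDecay.K₀ (4 * 2 ^ 4) (2 * 4)) /
          (1 - 36 * (ε * Real.exp 64 * B12TreeDecay.K₀ (4 * 2 ^ 4) (2 * 4))) ^ 2)) * cA))) :=
  ne5_of_recordOn_secant_structural (onSub S₀ M hMA hMB act) E₀ cB rI hrI
    ((B13StepOfRecordSub.transportReads_onSub_iff S₀ M hMA hMB act W).2 hT)
    ((B13StepOfRecordSub.sliceBudgetB_onSub_iff S₀ M hMA hMB act W κ cB).2 hbB)
    ((B13StepOfRecordSub.sliceBudget_onSub_iff S₀ M hMA hMB act E₀ cB W κ cA).2 hbA) hdA hdB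
    (B13StepOfRecordSub.operatorRate_onSub_of_weightedEntrywise S₀ M hMA hMB act E₀ cB hRA hRB hwer hc₁ hθ0.le hfl hr₀)
    hcomp hIA hirate hδI hGi hρ₁ hreachI hfib hAop0 hAop0' hdecop hεop h238op hΦopsmall hexp hN hN0 hNle hNbar habs hA0 hA0' hκ hdec hε
    h238 hRt hΦsmall hOp hHist hHistA hEA₀ hE₀ hE₁ hcA hcB (div_nonneg hc₁ hr₀.le) hθ0 hθθ' hθ'1 hω hω1 hρ₀ hρ₀1 hreach hB hfirst hsmall

/-- [folklore] **E8[rec] RE-POINTED (R20): THE SLOTS OF RECORD RESTRICTED TO A SUB-SLOT `M ∋` THE DATA OF RECORD — SAME ROOT, SAME LETTERS,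
OPERATOR-LINE BINDER OVER `↥M`.**  For `S₀ : B13StepOfRecord.Slots R E IOp Hist` and a ℂ-submodule `M ≤ OpDatum E` containing both runs'
operator data of record (`hMA`∕`hMB`): EXACTLY the displayed binder list of this lineage's `ne5_of_record_secant_structural` (p214566) — reading,
slice budgets, the quoted levels L05∕L06 for `B13StepOfRecord.outA∕outB S₀ E₀ cB`, W1 in row NE2's entry currency, the insertion composition
shape + datum membership + insertion rate + reach, the operator-side decay split + (2.38) shape, the history-side per-activity data, ONE rate
room, radii, numerics — EXCEPT that **`hfib : ActOpFibre … (restrict S₀ M hMA hMB).act (stepOn (restrict …) E₀ cB) W Aop`** (the cores OF RECORD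
read through the inclusion; operator lines `p.1 + ζ•u` with `u ∈ M`, `‖u‖ ≤ rOp k`) and `hexp`∕`hN`∕`habs` are stated on the sub-slot ball
class; conclusion LITERALLY `NE5 (B13StepOfRecord.outA S₀ E₀ cB) (B13StepOfRecord.outB S₀ E₀ cB) W κ θ′ C₅` with p214566's `C₅`
(`outA_restrict`∕`outB_restrict`, `rfl`); for `M := measOp` this is E8[rec] on R20's operator carrier OF RECORD.  NOT a proof of NE5. -/
theorem ne5_of_record_restrict_secant_structural {W : Set (ℕ → ℝ)} {ROp RHist : ℕ → ℝ}
    {N A A' Aop Aop' : ℕ → (ℕ → ℝ) → R.carriers.BgB → R.carriers.Dom → InnerLabel R.carriers.Dom (Bnd R) → ℝ}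
    {Dt : ActData R.carriers.Dom (InnerLabel R.carriers.Dom (Bnd R)) M Hist Ω}
    {κ Nbar ε εop Rt EA₀ E₁ cA c₁ r₀ Gi δI ρ₁ θ θ' ρ₀ B : ℝ} {k₀ k₁ : ℕ} (rI : ℕ → ℝ) (hrI : ∀ k, 0 < rI k)
    {Cfg : ℕ → Type*} [∀ k, NormedAddCommGroup (Cfg k)] [∀ k, NormedSpace ℂ (Cfg k)] {cfg : ∀ k, IOp → Cfg k}
    {Φ : ∀ k, (R.carriers.Dom → ℝ) → Cfg k → Hist} {𝒪 : ℕ → (ℕ → ℝ) → R.carriers.BgB → Set IOp}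
    {Dc : ∀ k, (ℕ → ℝ) → R.carriers.BgB → Set (Cfg k)}
    (hT : (assembly S₀).TransportReads W)
    (hbB : (assembly S₀).SliceBudgetB W κ cB) (hbA : S₀.D.SliceBudget (step S₀ E₀ cB) W κ cA)
    (hdA : DecayBound (B13StepOfRecord.outA S₀ E₀ cB) W EA₀ κ) (hdB : DecayBound (B13StepOfRecord.outB S₀ E₀ cB) W E₀ κ)
    (hRA : RawBounded S₀.F (assembly S₀).rawAt W) (hRB : RawBounded S₀.F S₀.rawB W)
    (hwer : WeightedEntrywiseRate S₀.F (assembly S₀).rawAt S₀.rawB W c₁ fun k => θ ^ k) (hfl : ∀ k, r₀ ≤ S₀.rOp k)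
    (hcomp : InsOpComposition (S₀.D.toInsOpModel (step S₀ E₀ cB) rI hrI) W κ E₀ Gi cfg Φ 𝒪 Dc)
    (hIA : ∀ k, ∀ g ∈ W, ∀ (U : R.carriers.BgB), (S₀.D.toInsOpModel (step S₀ E₀ cB) rI hrI).opIA g U k ∈ 𝒪 k g U)
    (hirate : (S₀.D.toInsOpModel (step S₀ E₀ cB) rI hrI).InsOpRate W δI θ) (hδI : 0 ≤ δI) (hGi : 0 ≤ Gi) (hρ₁ : ρ₁ < 1)
    (hreachI : δI * θ ^ k₁ ≤ ρ₁)
    (hfib : ActOpFibre (labelsIndexing (domainGeometry R) (b13InnerData R)) (restrict S₀ M hMA hMB).act (stepOn (restrict S₀ M hMA hMB) E₀ cB) W Aop)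
    (hAop0 : ∀ k g U Z ℓ, 0 ≤ Aop k g U Z ℓ) (hAop0' : ∀ k g U Z ℓ, 0 ≤ Aop' k g U Z ℓ)
    (hdecop : ∀ k g U Z ℓ, Aop k g U Z ℓ ≤ Aop' k g U Z ℓ * Real.exp (-(κ * (R.carriers.d Z + 5)))) (hεop : 0 ≤ εop)
    (h238op : ∀ k, ∀ g ∈ W, ∀ (U : R.carriers.BgB), ∀ Z ∈ R.domAt k,
      actSum (b13InnerData R) (Aop' k g U) k Z ≤ εop * Real.exp (-(Rt * R.carriers.d Z)))
    (hΦopsmall : 36 * (εop * Real.exp 64 * B12TreeDecay.K₀ (4 * 2 ^ 4) (2 * 4)) < 1)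
    (hexp : ActExpLinearOn (labelsIndexing (domainGeometry R) (b13InnerData R)) (restrict S₀ M hMA hMB).act Dt
      (ballClass (selfCtr (assemblyOn (restrict S₀ M hMA hMB)).raw (assemblyOn (restrict S₀ M hMA hMB)).histRef) ROp RHist) W)
    (hN : ActExpNormBound (labelsIndexing (domainGeometry R) (b13InnerData R)) Dt
      (ballClass (selfCtr (assemblyOn (restrict S₀ M hMA hMB)).raw (assemblyOn (restrict S₀ M hMA hMB)).histRef) ROp RHist) W S₀.rHist N)
    (hN0 : ∀ k g U Z ℓ, 0 ≤ N k g U Z ℓ) (hNle : ∀ k g U Z ℓ, N k g U Z ℓ ≤ Nbar) (hNbar : 0 ≤ Nbar)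
    (habs : ActAbsBound (labelsIndexing (domainGeometry R) (b13InnerData R)) Dt
      (ballClass (selfCtr (assemblyOn (restrict S₀ M hMA hMB)).raw (assemblyOn (restrict S₀ M hMA hMB)).histRef) ROp RHist) W A)
    (hA0 : ∀ k g U Z ℓ, 0 ≤ A k g U Z ℓ) (hA0' : ∀ k g U Z ℓ, 0 ≤ A' k g U Z ℓ) (hκ : 0 ≤ κ)
    (hdec : ∀ k g U Z ℓ, A k g U Z ℓ ≤ A' k g U Z ℓ * Real.exp (-(κ * (R.carriers.d Z + 5))))
    (hε : 0 ≤ ε)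
    (h238 : ∀ k, ∀ g ∈ W, ∀ (U : R.carriers.BgB), ∀ Z ∈ R.domAt k,
      actSum (b13InnerData R) (A' k g U) k Z ≤ ε * Real.exp (-(Rt * R.carriers.d Z)))
    (hRt : 64 * Real.log 162 + 64 ≤ Rt) (hΦsmall : 36 * (ε * Real.exp 64 * B12TreeDecay.K₀ (4 * 2 ^ 4) (2 * 4)) < 1)
    (hOp : ∀ k, c₁ / r₀ * S₀.rOp k ≤ ROp k) (hHist : ∀ k, (assembly S₀).bHist E₀ cB k ≤ RHist k)
    (hHistA : ∀ k, (Gi * δI / (1 - ρ₁) + 2 * Gi / θ ^ k₁) * S₀.rHist k + EA₀ * (S₀.rHist k * (cA / (1 - S₀.D.ω))) ≤ RHist k)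
    (hEA₀ : 0 ≤ EA₀) (hE₀ : 0 ≤ E₀) (hE₁ : 0 < E₁) (hcA : 0 ≤ cA) (hcB : 0 ≤ cB)
    (hc₁ : 0 ≤ c₁) (hr₀ : 0 < r₀) (hθ0 : 0 < θ) (hθθ' : θ ≤ θ') (hθ'1 : θ' ≤ 1) (hω : 0 < S₀.D.ω)
    (hω1 : S₀.D.ω < 1) (hρ₀ : 0 ≤ ρ₀) (hρ₀1 : ρ₀ < 1) (hreach : c₁ / r₀ * θ ^ k₀ ≤ ρ₀) (hB : 0 ≤ B)
    (hfirst : ∀ k < k₀, EA₀ + E₀ ≤ B * θ ^ k)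
    (hsmall : S₀.D.ω + 2 * (Nbar * ((ε * Real.exp 64 * B12TreeDecay.K₀ (4 * 2 ^ 4) (2 * 4)) /
          (1 - 36 * (ε * Real.exp 64 * B12TreeDecay.K₀ (4 * 2 ^ 4) (2 * 4))) ^ 2)) * cA < θ') :
    NE5 (B13StepOfRecord.outA S₀ E₀ cB) (B13StepOfRecord.outB S₀ E₀ cB) W κ θ'
      (((1 / (1 - ρ₀) * ((εop * Real.exp 64 * B12TreeDecay.K₀ (4 * 2 ^ 4) (2 * 4)) /
          (1 - 36 * (εop * Real.exp 64 * B12TreeDecay.K₀ (4 * 2 ^ 4) (2 * 4))) ^ 2)) * (c₁ / r₀) + 2 * (Nbar * ((ε * Real.exp 64 * B12TreeDecay.K₀ (4 * 2 ^ 4) (2 * 4)) /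
          (1 - 36 * (ε * Real.exp 64 * B12TreeDecay.K₀ (4 * 2 ^ 4) (2 * 4))) ^ 2)) *
          (Gi * δI / (1 - ρ₁) + 2 * Gi / θ ^ k₁) + B) * (θ' - S₀.D.ω) /
        (θ' - (S₀.D.ω + 2 * (Nbar * ((ε * Real.exp 64 * B12TreeDecay.K₀ (4 * 2 ^ 4) (2 * 4)) /
          (1 - 36 * (ε * Real.exp 64 * B12TreeDecay.K₀ (4 * 2 ^ 4) (2 * 4))) ^ 2)) * cA))) :=
  ne5_of_record_onSub_secant_structural S₀ M hMA hMB (fun Z ℓ o h => S₀.act Z ℓ (o : OpDatum E) h) E₀ cB rI hrI hT hbB hbA hdA hdB hRA hRB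
    hwer hfl hcomp hIA hirate hδI hGi hρ₁ hreachI hfib hAop0 hAop0' hdecop hεop h238op hΦopsmall hexp hN hN0 hNle hNbar habs hA0 hA0' hκ
    hdec hε h238 hRt hΦsmall hOp hHist hHistA hEA₀ hE₀ hE₁ hcA hcB hc₁ hr₀ hθ0 hθθ' hθ'1 hω hω1 hρ₀ hρ₀1 hreach hB hfirst hsmall

/-! ## §4 One level down ∕ across on the operator side, at the restricted slots of record -/

/-- [folklore] **E8[rec] RE-POINTED, FROM THE OWNER's STRUCTURAL CLASS `ActOpIntegral` OVER `↥M`**: §3 with `hfib := actOpFibre_of_integral hint`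
— each (2.14) factor of the cores of record, read through the inclusion, IS at each base point a dominated holomorphic parametric integral of
the operator datum on an operator domain IN `↥M` containing the closed operator ball, ONE majorant of mass `≤ Aop` (NOT PRINTED).  Same `C₅`. -/
theorem ne5_of_record_restrict_secant_integral {W : Set (ℕ → ℝ)} {ROp RHist : ℕ → ℝ}
    {N A A' Aop Aop' : ℕ → (ℕ → ℝ) → R.carriers.BgB → R.carriers.Dom → InnerLabel R.carriers.Dom (Bnd R) → ℝ}
    {Dt : ActData R.carriers.Dom (InnerLabel R.carriers.Dom (Bnd R)) M Hist Ω}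
    {κ Nbar ε εop Rt EA₀ E₁ cA c₁ r₀ Gi δI ρ₁ θ θ' ρ₀ B : ℝ} {k₀ k₁ : ℕ} (rI : ℕ → ℝ) (hrI : ∀ k, 0 < rI k)
    {Cfg : ℕ → Type*} [∀ k, NormedAddCommGroup (Cfg k)] [∀ k, NormedSpace ℂ (Cfg k)] {cfg : ∀ k, IOp → Cfg k}
    {Φ : ∀ k, (R.carriers.Dom → ℝ) → Cfg k → Hist} {𝒪 : ℕ → (ℕ → ℝ) → R.carriers.BgB → Set IOp}
    {Dc : ∀ k, (ℕ → ℝ) → R.carriers.BgB → Set (Cfg k)}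
    (hT : (assembly S₀).TransportReads W)
    (hbB : (assembly S₀).SliceBudgetB W κ cB) (hbA : S₀.D.SliceBudget (step S₀ E₀ cB) W κ cA)
    (hdA : DecayBound (B13StepOfRecord.outA S₀ E₀ cB) W EA₀ κ) (hdB : DecayBound (B13StepOfRecord.outB S₀ E₀ cB) W E₀ κ)
    (hRA : RawBounded S₀.F (assembly S₀).rawAt W) (hRB : RawBounded S₀.F S₀.rawB W)
    (hwer : WeightedEntrywiseRate S₀.F (assembly S₀).rawAt S₀.rawB W c₁ fun k => θ ^ k) (hfl : ∀ k, r₀ ≤ S₀.rOp k)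
    (hcomp : InsOpComposition (S₀.D.toInsOpModel (step S₀ E₀ cB) rI hrI) W κ E₀ Gi cfg Φ 𝒪 Dc)
    (hIA : ∀ k, ∀ g ∈ W, ∀ (U : R.carriers.BgB), (S₀.D.toInsOpModel (step S₀ E₀ cB) rI hrI).opIA g U k ∈ 𝒪 k g U)
    (hirate : (S₀.D.toInsOpModel (step S₀ E₀ cB) rI hrI).InsOpRate W δI θ) (hδI : 0 ≤ δI) (hGi : 0 ≤ Gi) (hρ₁ : ρ₁ < 1)
    (hreachI : δI * θ ^ k₁ ≤ ρ₁)
    {α : R.carriers.Dom → InnerLabel R.carriers.Dom (Bnd R) → Type*} [∀ Z j, MeasurableSpace (α Z j)]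
    {μ : ∀ Z j, ℕ → Hist → Measure (α Z j)} {f : ∀ Z j, ℕ → Hist → M → α Z j → ℂ}
    {𝒪op : ℕ → (ℕ → ℝ) → R.carriers.BgB → M × Hist → R.carriers.Dom → InnerLabel R.carriers.Dom (Bnd R) → Set M}
    (hint : ActOpIntegral (labelsIndexing (domainGeometry R) (b13InnerData R)) (restrict S₀ M hMA hMB).act (stepOn (restrict S₀ M hMA hMB) E₀ cB) W Aop μ f 𝒪op)
    (hAop0 : ∀ k g U Z ℓ, 0 ≤ Aop k g U Z ℓ) (hAop0' : ∀ k g U Z ℓ, 0 ≤ Aop' k g U Z ℓ)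
    (hdecop : ∀ k g U Z ℓ, Aop k g U Z ℓ ≤ Aop' k g U Z ℓ * Real.exp (-(κ * (R.carriers.d Z + 5)))) (hεop : 0 ≤ εop)
    (h238op : ∀ k, ∀ g ∈ W, ∀ (U : R.carriers.BgB), ∀ Z ∈ R.domAt k,
      actSum (b13InnerData R) (Aop' k g U) k Z ≤ εop * Real.exp (-(Rt * R.carriers.d Z)))
    (hΦopsmall : 36 * (εop * Real.exp 64 * B12TreeDecay.K₀ (4 * 2 ^ 4) (2 * 4)) < 1)
    (hexp : ActExpLinearOn (labelsIndexing (domainGeometry R) (b13InnerData R)) (restrict S₀ M hMA hMB).act Dt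
      (ballClass (selfCtr (assemblyOn (restrict S₀ M hMA hMB)).raw (assemblyOn (restrict S₀ M hMA hMB)).histRef) ROp RHist) W)
    (hN : ActExpNormBound (labelsIndexing (domainGeometry R) (b13InnerData R)) Dt
      (ballClass (selfCtr (assemblyOn (restrict S₀ M hMA hMB)).raw (assemblyOn (restrict S₀ M hMA hMB)).histRef) ROp RHist) W S₀.rHist N)
    (hN0 : ∀ k g U Z ℓ, 0 ≤ N k g U Z ℓ) (hNle : ∀ k g U Z ℓ, N k g U Z ℓ ≤ Nbar) (hNbar : 0 ≤ Nbar)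
    (habs : ActAbsBound (labelsIndexing (domainGeometry R) (b13InnerData R)) Dt
      (ballClass (selfCtr (assemblyOn (restrict S₀ M hMA hMB)).raw (assemblyOn (restrict S₀ M hMA hMB)).histRef) ROp RHist) W A)
    (hA0 : ∀ k g U Z ℓ, 0 ≤ A k g U Z ℓ) (hA0' : ∀ k g U Z ℓ, 0 ≤ A' k g U Z ℓ) (hκ : 0 ≤ κ)
    (hdec : ∀ k g U Z ℓ, A k g U Z ℓ ≤ A' k g U Z ℓ * Real.exp (-(κ * (R.carriers.d Z + 5))))
    (hε : 0 ≤ ε)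
    (h238 : ∀ k, ∀ g ∈ W, ∀ (U : R.carriers.BgB), ∀ Z ∈ R.domAt k,
      actSum (b13InnerData R) (A' k g U) k Z ≤ ε * Real.exp (-(Rt * R.carriers.d Z)))
    (hRt : 64 * Real.log 162 + 64 ≤ Rt) (hΦsmall : 36 * (ε * Real.exp 64 * B12TreeDecay.K₀ (4 * 2 ^ 4) (2 * 4)) < 1)
    (hOp : ∀ k, c₁ / r₀ * S₀.rOp k ≤ ROp k) (hHist : ∀ k, (assembly S₀).bHist E₀ cB k ≤ RHist k)
    (hHistA : ∀ k, (Gi * δI / (1 - ρ₁) + 2 * Gi / θ ^ k₁) * S₀.rHist k + EA₀ * (S₀.rHist k * (cA / (1 - S₀.D.ω))) ≤ RHist k)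
    (hEA₀ : 0 ≤ EA₀) (hE₀ : 0 ≤ E₀) (hE₁ : 0 < E₁) (hcA : 0 ≤ cA) (hcB : 0 ≤ cB)
    (hc₁ : 0 ≤ c₁) (hr₀ : 0 < r₀) (hθ0 : 0 < θ) (hθθ' : θ ≤ θ') (hθ'1 : θ' ≤ 1) (hω : 0 < S₀.D.ω)
    (hω1 : S₀.D.ω < 1) (hρ₀ : 0 ≤ ρ₀) (hρ₀1 : ρ₀ < 1) (hreach : c₁ / r₀ * θ ^ k₀ ≤ ρ₀) (hB : 0 ≤ B)
    (hfirst : ∀ k < k₀, EA₀ + E₀ ≤ B * θ ^ k)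
    (hsmall : S₀.D.ω + 2 * (Nbar * ((ε * Real.exp 64 * B12TreeDecay.K₀ (4 * 2 ^ 4) (2 * 4)) /
          (1 - 36 * (ε * Real.exp 64 * B12TreeDecay.K₀ (4 * 2 ^ 4) (2 * 4))) ^ 2)) * cA < θ') :
    NE5 (B13StepOfRecord.outA S₀ E₀ cB) (B13StepOfRecord.outB S₀ E₀ cB) W κ θ'
      (((1 / (1 - ρ₀) * ((εop * Real.exp 64 * B12TreeDecay.K₀ (4 * 2 ^ 4) (2 * 4)) /
          (1 - 36 * (εop * Real.exp 64 * B12TreeDecay.K₀ (4 * 2 ^ 4) (2 * 4))) ^ 2)) * (c₁ / r₀) + 2 * (Nbar * ((ε * Real.exp 64 * B12TreeDecay.K₀ (4 * 2 ^ 4) (2 * 4)) /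
          (1 - 36 * (ε * Real.exp 64 * B12TreeDecay.K₀ (4 * 2 ^ 4) (2 * 4))) ^ 2)) *
          (Gi * δI / (1 - ρ₁) + 2 * Gi / θ ^ k₁) + B) * (θ' - S₀.D.ω) /
        (θ' - (S₀.D.ω + 2 * (Nbar * ((ε * Real.exp 64 * B12TreeDecay.K₀ (4 * 2 ^ 4) (2 * 4)) /
          (1 - 36 * (ε * Real.exp 64 * B12TreeDecay.K₀ (4 * 2 ^ 4) (2 * 4))) ^ 2)) * cA))) :=
  ne5_of_record_restrict_secant_structural S₀ M hMA hMB E₀ cB rI hrI hT hbB hbA hdA hdB hRA hRB hwer hfl hcomp hIA hirate hδI hGi hρ₁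
    hreachI (actOpFibre_of_integral hint) hAop0 hAop0' hdecop hεop h238op hΦopsmall hexp hN hN0 hNle hNbar habs hA0 hA0' hκ hdec hε h238
    hRt hΦsmall hOp hHist hHistA hEA₀ hE₀ hE₁ hcA hcB hc₁ hr₀ hθ0 hθθ' hθ'1 hω hω1 hρ₀ hρ₀1 hreach hB hfirst hsmall

/-- [folklore] **E8[rec] RE-POINTED, FROM THE CAUCHY ROUTE's FACTOR DATUM OVER `↥M`**: §3 with `hfib :=` leaf-03's bridge
`actOpFibre_of_actOpLineAnalyticOn` — ROOM (`rOp ≤ ROp`, `bHist + rHist ≤ RHist`; leaf-03's `B13StepOfRecordSub.boxInClass`), the activity norm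
majorant `Aop` of the cores of record on the sub-slot ball class, and **`ActOpLineAnalyticOn … (restrict …).act (ballClass …) W`** — each factor
line analytic along operator segments IN `M` inside the class (the binder leaf-03's E9[rec]-sub reads too).  Same root, same `C₅`. -/
theorem ne5_of_record_restrict_secant_lineAnalytic {W : Set (ℕ → ℝ)} {ROp RHist : ℕ → ℝ}
    {N A A' Aop Aop' : ℕ → (ℕ → ℝ) → R.carriers.BgB → R.carriers.Dom → InnerLabel R.carriers.Dom (Bnd R) → ℝ}
    {Dt : ActData R.carriers.Dom (InnerLabel R.carriers.Dom (Bnd R)) M Hist Ω}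
    {κ Nbar ε εop Rt EA₀ E₁ cA c₁ r₀ Gi δI ρ₁ θ θ' ρ₀ B : ℝ} {k₀ k₁ : ℕ} (rI : ℕ → ℝ) (hrI : ∀ k, 0 < rI k)
    {Cfg : ℕ → Type*} [∀ k, NormedAddCommGroup (Cfg k)] [∀ k, NormedSpace ℂ (Cfg k)] {cfg : ∀ k, IOp → Cfg k}
    {Φ : ∀ k, (R.carriers.Dom → ℝ) → Cfg k → Hist} {𝒪 : ℕ → (ℕ → ℝ) → R.carriers.BgB → Set IOp}
    {Dc : ∀ k, (ℕ → ℝ) → R.carriers.BgB → Set (Cfg k)}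
    (hT : (assembly S₀).TransportReads W)
    (hbB : (assembly S₀).SliceBudgetB W κ cB) (hbA : S₀.D.SliceBudget (step S₀ E₀ cB) W κ cA)
    (hdA : DecayBound (B13StepOfRecord.outA S₀ E₀ cB) W EA₀ κ) (hdB : DecayBound (B13StepOfRecord.outB S₀ E₀ cB) W E₀ κ)
    (hRA : RawBounded S₀.F (assembly S₀).rawAt W) (hRB : RawBounded S₀.F S₀.rawB W)
    (hwer : WeightedEntrywiseRate S₀.F (assembly S₀).rawAt S₀.rawB W c₁ fun k => θ ^ k) (hfl : ∀ k, r₀ ≤ S₀.rOp k)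
    (hcomp : InsOpComposition (S₀.D.toInsOpModel (step S₀ E₀ cB) rI hrI) W κ E₀ Gi cfg Φ 𝒪 Dc)
    (hIA : ∀ k, ∀ g ∈ W, ∀ (U : R.carriers.BgB), (S₀.D.toInsOpModel (step S₀ E₀ cB) rI hrI).opIA g U k ∈ 𝒪 k g U)
    (hirate : (S₀.D.toInsOpModel (step S₀ E₀ cB) rI hrI).InsOpRate W δI θ) (hδI : 0 ≤ δI) (hGi : 0 ≤ Gi) (hρ₁ : ρ₁ < 1)
    (hreachI : δI * θ ^ k₁ ≤ ρ₁)
    (hOp' : ∀ k, S₀.rOp k ≤ ROp k) (hHist' : ∀ k, (assembly S₀).bHist E₀ cB k + S₀.rHist k ≤ RHist k)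
    (hAK : ∀ k, ∀ g ∈ W, ∀ (U : R.carriers.BgB) (q : M × Hist),
      q ∈ ballClass (selfCtr (assemblyOn (restrict S₀ M hMA hMB)).raw (assemblyOn (restrict S₀ M hMA hMB)).histRef) ROp RHist k g U →
        ∀ X : R.carriers.Dom, R.carriers.scale X = k → ∀ i, (labelsIndexing (domainGeometry R) (b13InnerData R)).Rel k i X → ∀ m,
          ‖S₀.act ((labelsIndexing (domainGeometry R) (b13InnerData R)).poly i m)
              ((labelsIndexing (domainGeometry R) (b13InnerData R)).lab i m) (q.1 : OpDatum E) q.2‖ ≤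
            Aop k g U ((labelsIndexing (domainGeometry R) (b13InnerData R)).poly i m)
              ((labelsIndexing (domainGeometry R) (b13InnerData R)).lab i m))
    (hact : ActOpLineAnalyticOn (labelsIndexing (domainGeometry R) (b13InnerData R)) (restrict S₀ M hMA hMB).act
      (ballClass (selfCtr (assemblyOn (restrict S₀ M hMA hMB)).raw (assemblyOn (restrict S₀ M hMA hMB)).histRef) ROp RHist) W)
    (hAop0 : ∀ k g U Z ℓ, 0 ≤ Aop k g U Z ℓ) (hAop0' : ∀ k g U Z ℓ, 0 ≤ Aop' k g U Z ℓ)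
    (hdecop : ∀ k g U Z ℓ, Aop k g U Z ℓ ≤ Aop' k g U Z ℓ * Real.exp (-(κ * (R.carriers.d Z + 5)))) (hεop : 0 ≤ εop)
    (h238op : ∀ k, ∀ g ∈ W, ∀ (U : R.carriers.BgB), ∀ Z ∈ R.domAt k,
      actSum (b13InnerData R) (Aop' k g U) k Z ≤ εop * Real.exp (-(Rt * R.carriers.d Z)))
    (hΦopsmall : 36 * (εop * Real.exp 64 * B12TreeDecay.K₀ (4 * 2 ^ 4) (2 * 4)) < 1)
    (hexp : ActExpLinearOn (labelsIndexing (domainGeometry R) (b13InnerData R)) (restrict S₀ M hMA hMB).act Dt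
      (ballClass (selfCtr (assemblyOn (restrict S₀ M hMA hMB)).raw (assemblyOn (restrict S₀ M hMA hMB)).histRef) ROp RHist) W)
    (hN : ActExpNormBound (labelsIndexing (domainGeometry R) (b13InnerData R)) Dt
      (ballClass (selfCtr (assemblyOn (restrict S₀ M hMA hMB)).raw (assemblyOn (restrict S₀ M hMA hMB)).histRef) ROp RHist) W S₀.rHist N)
    (hN0 : ∀ k g U Z ℓ, 0 ≤ N k g U Z ℓ) (hNle : ∀ k g U Z ℓ, N k g U Z ℓ ≤ Nbar) (hNbar : 0 ≤ Nbar)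
    (habs : ActAbsBound (labelsIndexing (domainGeometry R) (b13InnerData R)) Dt
      (ballClass (selfCtr (assemblyOn (restrict S₀ M hMA hMB)).raw (assemblyOn (restrict S₀ M hMA hMB)).histRef) ROp RHist) W A)
    (hA0 : ∀ k g U Z ℓ, 0 ≤ A k g U Z ℓ) (hA0' : ∀ k g U Z ℓ, 0 ≤ A' k g U Z ℓ) (hκ : 0 ≤ κ)
    (hdec : ∀ k g U Z ℓ, A k g U Z ℓ ≤ A' k g U Z ℓ * Real.exp (-(κ * (R.carriers.d Z + 5))))
    (hε : 0 ≤ ε)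
    (h238 : ∀ k, ∀ g ∈ W, ∀ (U : R.carriers.BgB), ∀ Z ∈ R.domAt k,
      actSum (b13InnerData R) (A' k g U) k Z ≤ ε * Real.exp (-(Rt * R.carriers.d Z)))
    (hRt : 64 * Real.log 162 + 64 ≤ Rt) (hΦsmall : 36 * (ε * Real.exp 64 * B12TreeDecay.K₀ (4 * 2 ^ 4) (2 * 4)) < 1)
    (hOp : ∀ k, c₁ / r₀ * S₀.rOp k ≤ ROp k) (hHist : ∀ k, (assembly S₀).bHist E₀ cB k ≤ RHist k)
    (hHistA : ∀ k, (Gi * δI / (1 - ρ₁) + 2 * Gi / θ ^ k₁) * S₀.rHist k + EA₀ * (S₀.rHist k * (cA / (1 - S₀.D.ω))) ≤ RHist k)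
    (hEA₀ : 0 ≤ EA₀) (hE₀ : 0 ≤ E₀) (hE₁ : 0 < E₁) (hcA : 0 ≤ cA) (hcB : 0 ≤ cB)
    (hc₁ : 0 ≤ c₁) (hr₀ : 0 < r₀) (hθ0 : 0 < θ) (hθθ' : θ ≤ θ') (hθ'1 : θ' ≤ 1) (hω : 0 < S₀.D.ω)
    (hω1 : S₀.D.ω < 1) (hρ₀ : 0 ≤ ρ₀) (hρ₀1 : ρ₀ < 1) (hreach : c₁ / r₀ * θ ^ k₀ ≤ ρ₀) (hB : 0 ≤ B)
    (hfirst : ∀ k < k₀, EA₀ + E₀ ≤ B * θ ^ k)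
    (hsmall : S₀.D.ω + 2 * (Nbar * ((ε * Real.exp 64 * B12TreeDecay.K₀ (4 * 2 ^ 4) (2 * 4)) /
          (1 - 36 * (ε * Real.exp 64 * B12TreeDecay.K₀ (4 * 2 ^ 4) (2 * 4))) ^ 2)) * cA < θ') :
    NE5 (B13StepOfRecord.outA S₀ E₀ cB) (B13StepOfRecord.outB S₀ E₀ cB) W κ θ'
      (((1 / (1 - ρ₀) * ((εop * Real.exp 64 * B12TreeDecay.K₀ (4 * 2 ^ 4) (2 * 4)) /
          (1 - 36 * (εop * Real.exp 64 * B12TreeDecay.K₀ (4 * 2 ^ 4) (2 * 4))) ^ 2)) * (c₁ / r₀) + 2 * (Nbar * ((ε * Real.exp 64 * B12TreeDecay.K₀ (4 * 2 ^ 4) (2 * 4)) /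
          (1 - 36 * (ε * Real.exp 64 * B12TreeDecay.K₀ (4 * 2 ^ 4) (2 * 4))) ^ 2)) *
          (Gi * δI / (1 - ρ₁) + 2 * Gi / θ ^ k₁) + B) * (θ' - S₀.D.ω) /
        (θ' - (S₀.D.ω + 2 * (Nbar * ((ε * Real.exp 64 * B12TreeDecay.K₀ (4 * 2 ^ 4) (2 * 4)) /
          (1 - 36 * (ε * Real.exp 64 * B12TreeDecay.K₀ (4 * 2 ^ 4) (2 * 4))) ^ 2)) * cA))) :=
  ne5_of_record_restrict_secant_structural S₀ M hMA hMB E₀ cB rI hrI hT hbB hbA hdA hdB hRA hRB hwer hfl hcomp hIA hirate hδI hGi hρ₁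
    hreachI (actOpFibre_of_actOpLineAnalyticOn (B13StepOfRecordSub.boxInClass (restrict S₀ M hMA hMB) E₀ cB W hOp' hHist') hAK hact) hAop0 hAop0'
    hdecop hεop h238op hΦopsmall hexp hN hN0 hNle hNbar habs hA0 hA0' hκ hdec hε h238 hRt hΦsmall hOp hHist hHistA hEA₀ hE₀ hE₁ hcA hcB
    hc₁ hr₀ hθ0 hθθ' hθ'1 hω hω1 hρ₀ hρ₀1 hreach hB hfirst hsmall

/-! ## §5 Leaf L10's letters `k₀`, `B` ELIMINATED at the restricted slots -/

/-- [folklore] **THE RE-POINTED E8[rec] WITHOUT THE L10 LETTERS**: with `0 < θ < 1` and `0 < ρ₀` the operator reach scale `k₀` and the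
first-scales constant `B` EXIST (leaf-10's `OutputRateArithmetic.reach_scale_exists`, `OutputRateResidual.first_scales_const`), `E₁ := 1`, so §3
gives `∃ C₅, NE5 (B13StepOfRecord.outA S₀ E₀ cB) (B13StepOfRecord.outB S₀ E₀ cB) W κ θ′ C₅` from the remaining displayed binders — over `↥M`. -/
theorem exists_ne5_of_record_restrict_secant_structural {W : Set (ℕ → ℝ)} {ROp RHist : ℕ → ℝ}
    {N A A' Aop Aop' : ℕ → (ℕ → ℝ) → R.carriers.BgB → R.carriers.Dom → InnerLabel R.carriers.Dom (Bnd R) → ℝ}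
    {Dt : ActData R.carriers.Dom (InnerLabel R.carriers.Dom (Bnd R)) M Hist Ω}
    {κ Nbar ε εop Rt EA₀ cA c₁ r₀ Gi δI ρ₁ θ θ' ρ₀ : ℝ} {k₁ : ℕ} (rI : ℕ → ℝ) (hrI : ∀ k, 0 < rI k)
    {Cfg : ℕ → Type*} [∀ k, NormedAddCommGroup (Cfg k)] [∀ k, NormedSpace ℂ (Cfg k)] {cfg : ∀ k, IOp → Cfg k}
    {Φ : ∀ k, (R.carriers.Dom → ℝ) → Cfg k → Hist} {𝒪 : ℕ → (ℕ → ℝ) → R.carriers.BgB → Set IOp}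
    {Dc : ∀ k, (ℕ → ℝ) → R.carriers.BgB → Set (Cfg k)}
    (hT : (assembly S₀).TransportReads W)
    (hbB : (assembly S₀).SliceBudgetB W κ cB) (hbA : S₀.D.SliceBudget (step S₀ E₀ cB) W κ cA)
    (hdA : DecayBound (B13StepOfRecord.outA S₀ E₀ cB) W EA₀ κ) (hdB : DecayBound (B13StepOfRecord.outB S₀ E₀ cB) W E₀ κ)
    (hRA : RawBounded S₀.F (assembly S₀).rawAt W) (hRB : RawBounded S₀.F S₀.rawB W)
    (hwer : WeightedEntrywiseRate S₀.F (assembly S₀).rawAt S₀.rawB W c₁ fun k => θ ^ k) (hfl : ∀ k, r₀ ≤ S₀.rOp k)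
    (hcomp : InsOpComposition (S₀.D.toInsOpModel (step S₀ E₀ cB) rI hrI) W κ E₀ Gi cfg Φ 𝒪 Dc)
    (hIA : ∀ k, ∀ g ∈ W, ∀ (U : R.carriers.BgB), (S₀.D.toInsOpModel (step S₀ E₀ cB) rI hrI).opIA g U k ∈ 𝒪 k g U)
    (hirate : (S₀.D.toInsOpModel (step S₀ E₀ cB) rI hrI).InsOpRate W δI θ) (hδI : 0 ≤ δI) (hGi : 0 ≤ Gi) (hρ₁ : ρ₁ < 1)
    (hreachI : δI * θ ^ k₁ ≤ ρ₁)
    (hfib : ActOpFibre (labelsIndexing (domainGeometry R) (b13InnerData R)) (restrict S₀ M hMA hMB).act (stepOn (restrict S₀ M hMA hMB) E₀ cB) W Aop)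
    (hAop0 : ∀ k g U Z ℓ, 0 ≤ Aop k g U Z ℓ) (hAop0' : ∀ k g U Z ℓ, 0 ≤ Aop' k g U Z ℓ)
    (hdecop : ∀ k g U Z ℓ, Aop k g U Z ℓ ≤ Aop' k g U Z ℓ * Real.exp (-(κ * (R.carriers.d Z + 5)))) (hεop : 0 ≤ εop)
    (h238op : ∀ k, ∀ g ∈ W, ∀ (U : R.carriers.BgB), ∀ Z ∈ R.domAt k,
      actSum (b13InnerData R) (Aop' k g U) k Z ≤ εop * Real.exp (-(Rt * R.carriers.d Z)))
    (hΦopsmall : 36 * (εop * Real.exp 64 * B12TreeDecay.K₀ (4 * 2 ^ 4) (2 * 4)) < 1)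
    (hexp : ActExpLinearOn (labelsIndexing (domainGeometry R) (b13InnerData R)) (restrict S₀ M hMA hMB).act Dt
      (ballClass (selfCtr (assemblyOn (restrict S₀ M hMA hMB)).raw (assemblyOn (restrict S₀ M hMA hMB)).histRef) ROp RHist) W)
    (hN : ActExpNormBound (labelsIndexing (domainGeometry R) (b13InnerData R)) Dt
      (ballClass (selfCtr (assemblyOn (restrict S₀ M hMA hMB)).raw (assemblyOn (restrict S₀ M hMA hMB)).histRef) ROp RHist) W S₀.rHist N)
    (hN0 : ∀ k g U Z ℓ, 0 ≤ N k g U Z ℓ) (hNle : ∀ k g U Z ℓ, N k g U Z ℓ ≤ Nbar) (hNbar : 0 ≤ Nbar)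
    (habs : ActAbsBound (labelsIndexing (domainGeometry R) (b13InnerData R)) Dt
      (ballClass (selfCtr (assemblyOn (restrict S₀ M hMA hMB)).raw (assemblyOn (restrict S₀ M hMA hMB)).histRef) ROp RHist) W A)
    (hA0 : ∀ k g U Z ℓ, 0 ≤ A k g U Z ℓ) (hA0' : ∀ k g U Z ℓ, 0 ≤ A' k g U Z ℓ) (hκ : 0 ≤ κ)
    (hdec : ∀ k g U Z ℓ, A k g U Z ℓ ≤ A' k g U Z ℓ * Real.exp (-(κ * (R.carriers.d Z + 5))))
    (hε : 0 ≤ ε)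
    (h238 : ∀ k, ∀ g ∈ W, ∀ (U : R.carriers.BgB), ∀ Z ∈ R.domAt k,
      actSum (b13InnerData R) (A' k g U) k Z ≤ ε * Real.exp (-(Rt * R.carriers.d Z)))
    (hRt : 64 * Real.log 162 + 64 ≤ Rt) (hΦsmall : 36 * (ε * Real.exp 64 * B12TreeDecay.K₀ (4 * 2 ^ 4) (2 * 4)) < 1)
    (hOp : ∀ k, c₁ / r₀ * S₀.rOp k ≤ ROp k) (hHist : ∀ k, (assembly S₀).bHist E₀ cB k ≤ RHist k)
    (hHistA : ∀ k, (Gi * δI / (1 - ρ₁) + 2 * Gi / θ ^ k₁) * S₀.rHist k + EA₀ * (S₀.rHist k * (cA / (1 - S₀.D.ω))) ≤ RHist k)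
    (hEA₀ : 0 ≤ EA₀) (hE₀ : 0 ≤ E₀) (hcA : 0 ≤ cA) (hcB : 0 ≤ cB)
    (hc₁ : 0 ≤ c₁) (hr₀ : 0 < r₀) (hθ0 : 0 < θ) (hθ1 : θ < 1) (hθθ' : θ ≤ θ') (hθ'1 : θ' ≤ 1) (hω : 0 < S₀.D.ω)
    (hω1 : S₀.D.ω < 1) (hρ₀ : 0 < ρ₀) (hρ₀1 : ρ₀ < 1)
    (hsmall : S₀.D.ω + 2 * (Nbar * ((ε * Real.exp 64 * B12TreeDecay.K₀ (4 * 2 ^ 4) (2 * 4)) /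
          (1 - 36 * (ε * Real.exp 64 * B12TreeDecay.K₀ (4 * 2 ^ 4) (2 * 4))) ^ 2)) * cA < θ') :
    ∃ C₅, NE5 (B13StepOfRecord.outA S₀ E₀ cB) (B13StepOfRecord.outB S₀ E₀ cB) W κ θ' C₅ := by
  obtain ⟨k₀, hk₀⟩ := OutputRateArithmetic.reach_scale_exists (D := c₁ / r₀) (h := 0) (div_nonneg hc₁ hr₀.le) hθ1 hρ₀
  rw [add_zero] at hk₀
  exact ⟨_, ne5_of_record_restrict_secant_structural S₀ M hMA hMB E₀ cB rI hrI hT hbB hbA hdA hdB hRA hRB hwer hfl hcomp hIA hirate hδI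
    hGi hρ₁ hreachI hfib hAop0 hAop0' hdecop hεop h238op hΦopsmall hexp hN hN0 hNle hNbar habs hA0 hA0' hκ hdec hε h238 hRt hΦsmall hOp
    hHist hHistA hEA₀ hE₀ (one_pos : (0 : ℝ) < 1) hcA hcB hc₁ hr₀ hθ0 hθθ' hθ'1 hω hω1 hρ₀.le hρ₀1 hk₀ (le_max_left 0 ((EA₀ + E₀) / θ ^ k₀))
    (fun k hk => OutputRateResidual.first_scales_const hθ0 hθ1.le hk.le) hsmall⟩

end OnSub

end Summit.QuantumFields.BalabanUV.T4Continuum.B13StepOfRecordSecantStructuralSub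

end
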